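import Literature.Probability.LatticeModels.CoarseCellMixingDefectsFarChains
import HarnessLib

/-!
# Coarse-cell mixing with defects: counting the cluster shapes attached to a seed

Companion ("theorems only") file of the coarse-cell defect series. The expansion around the bad
cluster attached to a seed `Sd` (linking range `1`) is a finite sum over CLUSTER SHAPES
(`clusterShapes 1 univ Sd`: sets equal to their own closure from `Sd`); its convergence needs an
entropy bound. A cluster shape is the union over its seed cells `s` of the components
`seedClosure (cdist ≤ 1) K {s}`, each empty or a connected set through `s`; counting the tuples of
components with the lattice-animal bound gives at most `B^m` shapes of cardinality `m ≥ 1`,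
`B = (2 (3^d+1)^2)^{|Sd|}` (`card_clusterShapes_filter_card_le`), whence the weighted bound
`Σ_{K ≠ ∅} z^{|K|} (a + b |K|) ≤ 4 (a + b) B z` for `0 ≤ z`, `4 B z ≤ 1`
(`sum_clusterShapes_le`).

## References

* S. Friedli, Y. Velenik, *Statistical Mechanics of Lattice Systems* (CUP 2017), §3.7.2, §5.7.
-/

noncomputable section

namespace Literature.Probability.LatticeModels

variable {d : ℕ} {μc : Fin d → ℕ}

/-- The component of the seed cell `s` inside `K` (linking range `1`). [folklore] -/
private abbrev comp (K : Finset (CoarseIdx μc)) (s : CoarseIdx μc) : Finset (CoarseIdx μc) :=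
  seedClosure (fun x y : CoarseIdx μc => cdist x y ≤ 1) K {s}

/-- A cluster shape is the union of the components of its seed cells. [folklore] -/
theorem IsClusterShape.eq_biUnion_comp {Sd K : Finset (CoarseIdx μc)}
    (hK : IsClusterShape (fun x y : CoarseIdx μc => cdist x y ≤ 1) Sd K) :
    K = Sd.biUnion fun s => seedClosure (fun x y : CoarseIdx μc => cdist x y ≤ 1) K {s} := by
  ext c
  rw [Finset.mem_biUnion]
  constructor
  · intro hc
    have hc' : c ∈ seedClosure (fun x y : CoarseIdx μc => cdist x y ≤ 1) K Sd := by
      rw [hK]; exact hc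
    obtain ⟨hcK, s, hs, hsK, hchain⟩ := mem_seedClosure.1 hc'
    exact ⟨s, hs, mem_seedClosure.2 ⟨hcK, s, Finset.mem_singleton_self _, hsK, hchain⟩⟩
  · rintro ⟨s, -, hc⟩
    exact seedClosure_subset _ _ hc

/-- Each component of a seed cell is empty or a connected set through that cell. [folklore] -/
theorem comp_empty_or_connected (K : Finset (CoarseIdx μc)) (s : CoarseIdx μc) :
    seedClosure (fun x y : CoarseIdx μc => cdist x y ≤ 1) K {s} = ∅ ∨
      (s ∈ seedClosure (fun x y : CoarseIdx μc => cdist x y ≤ 1) K {s} ∧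
        IsCellConnectedFrom s (seedClosure (fun x y : CoarseIdx μc => cdist x y ≤ 1) K {s})) := by
  by_cases hs : s ∈ K
  · right
    refine ⟨mem_seedClosure.2 ⟨hs, s, Finset.mem_singleton_self _, hs, Relation.ReflTransGen.refl⟩,
      fun w hw => ?_⟩
    obtain ⟨s', hs', -, hchain⟩ := seedClosure_connected hw
    rw [Finset.mem_singleton] at hs'
    subst hs'
    exact hchain
  · left
    rw [Finset.eq_empty_iff_forall_notMem]
    intro c hc
    obtain ⟨-, s', hs', hs'K, -⟩ := mem_seedClosure.1 hc
    rw [Finset.mem_singleton] at hs'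
    exact hs (hs' ▸ hs'K)

/-- **At most `B^m` cluster shapes of cardinality `m ≥ 1`**, `B = (2 (3^d+1)^2)^{|Sd|}`: a shape is
determined by the tuple of the components of its seed cells, each empty or a connected set of at
most `m` cells through the seed cell, of which there are at most `1 + (3^d+1)^{2(m-1)} ≤ (2(3^d+1)^2)^m`.
[folklore] -/
theorem card_clusterShapes_filter_card_le (Sd : Finset (CoarseIdx μc)) {m : ℕ} (hm : 1 ≤ m) :
    (((clusterShapes 1 Finset.univ Sd).filter fun K => K.card = m).card : ℝ) ≤
      ((2 * ((3 : ℝ) ^ d + 1) ^ 2) ^ Sd.card) ^ m := by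
  classical
  -- the admissible components of a seed cell
  let 𝒜 : CoarseIdx μc → Finset (Finset (CoarseIdx μc)) := fun s =>
    Finset.univ.filter fun A => A = ∅ ∨ (s ∈ A ∧ IsCellConnectedFrom s A ∧ A.card ≤ m)
  have h𝒜 : ∀ s, ((𝒜 s).card : ℝ) ≤ (2 * ((3 : ℝ) ^ d + 1) ^ 2) ^ m := by
    intro s
    have hsplit : 𝒜 s ⊆ insert ∅ (Finset.univ.filter fun A : Finset (CoarseIdx μc) =>
        s ∈ A ∧ IsCellConnectedFrom s A ∧ A.card ≤ m) := by
      intro A hA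
      rcases (Finset.mem_filter.1 hA).2 with h | h
      · exact h ▸ Finset.mem_insert_self _ _
      · exact Finset.mem_insert_of_mem (Finset.mem_filter.2 ⟨Finset.mem_univ _, h⟩)
    have hconn : (Finset.univ.filter fun A : Finset (CoarseIdx μc) =>
        s ∈ A ∧ IsCellConnectedFrom s A ∧ A.card ≤ m).card ≤ (3 ^ d + 1) ^ (2 * (m - 1)) := by
      refine card_connectedCellFamily_le s (m - 1) _ fun A hA => ?_
      obtain ⟨-, hsA, hc, hcard⟩ := Finset.mem_filter.1 hA
      exact ⟨hsA, by omega, hc⟩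
    have h1 : ((𝒜 s).card : ℝ) ≤ 1 + (3 ^ d + 1) ^ (2 * (m - 1)) := by
      have h := (Finset.card_le_card hsplit).trans (Finset.card_insert_le _ _)
      have h' : (𝒜 s).card ≤ (3 ^ d + 1) ^ (2 * (m - 1)) + 1 := h.trans (by omega)
      calc ((𝒜 s).card : ℝ) ≤ (((3 ^ d + 1) ^ (2 * (m - 1)) + 1 : ℕ) : ℝ) := by exact_mod_cast h'
        _ = 1 + (3 ^ d + 1) ^ (2 * (m - 1)) := by push_cast; ring
    refine h1.trans ?_
    -- `1 + X^{m-1} ≤ (2X)^m` for `X = (3^d+1)^2 ≥ 1`, `m ≥ 1`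
    set X : ℝ := ((3 : ℝ) ^ d + 1) ^ 2 with hX
    have hX1 : 1 ≤ X := by
      rw [hX]
      have h3 : (1 : ℝ) ≤ (3 : ℝ) ^ d + 1 := by
        have : (0 : ℝ) ≤ 3 ^ d := by positivity
        linarith
      exact one_le_pow₀ h3
    have hpow : ((3 : ℝ) ^ d + 1) ^ (2 * (m - 1)) = X ^ (m - 1) := by rw [hX, ← pow_mul]
    rw [hpow, mul_pow]
    obtain ⟨k, rfl⟩ : ∃ k, m = k + 1 := ⟨m - 1, by omega⟩
    simp only [add_tsub_cancel_right]
    have h2 : (2 : ℝ) ^ (k + 1) = 2 * 2 ^ k := by rw [pow_succ]; ring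
    have hXk : X ^ (k + 1) = X ^ k * X := pow_succ X k
    have hk1 : (1 : ℝ) ≤ 2 ^ k := one_le_pow₀ (by norm_num)
    have hXk1 : (1 : ℝ) ≤ X ^ k := one_le_pow₀ hX1
    rw [h2, hXk]
    nlinarith [mul_nonneg (sub_nonneg.2 hk1) (sub_nonneg.2 hXk1), mul_nonneg (by positivity : (0:ℝ) ≤ 2 ^ k * X ^ k) (sub_nonneg.2 hX1)]
  -- the injection into tuples of components
  set φ : Finset (CoarseIdx μc) → ((s : CoarseIdx μc) → s ∈ Sd → Finset (CoarseIdx μc)) :=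
    fun K s _ => comp K s with hφ
  have hmaps : ∀ K ∈ (clusterShapes 1 Finset.univ Sd).filter (fun K => K.card = m),
      φ K ∈ Sd.pi 𝒜 := by
    intro K hK
    obtain ⟨hK, hKm⟩ := Finset.mem_filter.1 hK
    rw [Finset.mem_pi]
    intro s hs
    refine Finset.mem_filter.2 ⟨Finset.mem_univ _, ?_⟩
    rcases comp_empty_or_connected K s with h | ⟨hsc, hconn⟩
    · exact Or.inl h
    · exact Or.inr ⟨hsc, hconn, hKm ▸ Finset.card_le_card (seedClosure_subset _ _)⟩
  have hinj : Set.InjOn φ ↑((clusterShapes 1 Finset.univ Sd).filter fun K => K.card = m) := by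
    intro K hK K' hK' hKK'
    have hK1 := (mem_clusterShapes.1 (Finset.mem_filter.1 (Finset.mem_coe.1 hK)).1).2
    have hK'1 := (mem_clusterShapes.1 (Finset.mem_filter.1 (Finset.mem_coe.1 hK')).1).2
    rw [hK1.eq_biUnion_comp, hK'1.eq_biUnion_comp]
    refine Finset.biUnion_congr rfl fun s hs => ?_
    have := congrFun (congrFun hKK' s) hs
    exact this
  have hcard := Finset.card_le_card_of_injOn φ hmaps hinj
  rw [Finset.card_pi] at hcard
  calc (((clusterShapes 1 Finset.univ Sd).filter fun K => K.card = m).card : ℝ)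
      ≤ ((∏ s ∈ Sd, (𝒜 s).card : ℕ) : ℝ) := by exact_mod_cast hcard
    _ = ∏ s ∈ Sd, ((𝒜 s).card : ℝ) := by push_cast; rfl
    _ ≤ ∏ _s ∈ Sd, (2 * ((3 : ℝ) ^ d + 1) ^ 2) ^ m :=
        Finset.prod_le_prod (fun s _ => Nat.cast_nonneg _) fun s _ => h𝒜 s
    _ = ((2 * ((3 : ℝ) ^ d + 1) ^ 2) ^ Sd.card) ^ m := by
        rw [Finset.prod_const, ← pow_mul, ← pow_mul, Nat.mul_comm]

/-- **Weighted sum over the nonempty cluster shapes of a seed**: for `0 ≤ z` with `4 B z ≤ 1`,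
`B = (2(3^d+1)^2)^{|Sd|}`, and `a, b ≥ 0`,
`Σ_{K ∈ clusterShapes, K ≠ ∅} z^{|K|} (a + b |K|) ≤ 4 (a + b) B z` (group by cardinality,
`a + b m ≤ (a + b) 2^m`, geometric series in `2 B z ≤ 1/2`). [folklore] -/
theorem sum_clusterShapes_le (Sd : Finset (CoarseIdx μc)) {z a b : ℝ} (hz : 0 ≤ z) (ha : 0 ≤ a)
    (hb : 0 ≤ b) (hBz : 4 * (2 * ((3 : ℝ) ^ d + 1) ^ 2) ^ Sd.card * z ≤ 1) :
    ∑ K ∈ (clusterShapes 1 Finset.univ Sd).filter (fun K => K.Nonempty),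
        z ^ K.card * (a + b * K.card) ≤
      4 * (a + b) * (2 * ((3 : ℝ) ^ d + 1) ^ 2) ^ Sd.card * z := by
  classical
  set B : ℝ := (2 * ((3 : ℝ) ^ d + 1) ^ 2) ^ Sd.card with hB
  have hB0 : 0 < B := by positivity
  set N : ℕ := Fintype.card (CoarseIdx μc) with hN
  set 𝒮 := (clusterShapes 1 Finset.univ Sd).filter (fun K => K.Nonempty) with h𝒮
  -- group by cardinality
  have hsplit : ∑ K ∈ 𝒮, z ^ K.card * (a + b * K.card) =
      ∑ m ∈ Finset.Ico 1 (N + 1),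
        ∑ K ∈ (clusterShapes 1 Finset.univ Sd).filter (fun K => K.card = m),
          z ^ K.card * (a + b * K.card) := by
    rw [← Finset.sum_biUnion]
    · apply Finset.sum_congr _ fun _ _ => rfl
      ext K
      simp only [h𝒮, Finset.mem_biUnion, Finset.mem_Ico, Finset.mem_filter]
      constructor
      · rintro ⟨hK, hne⟩
        have h1 : 1 ≤ K.card := Finset.card_pos.2 hne
        have h2 : K.card ≤ N := by
          rw [hN, ← Finset.card_univ]; exact Finset.card_le_card (Finset.subset_univ _)
        exact ⟨K.card, ⟨h1, by omega⟩, hK, rfl⟩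
      · rintro ⟨m, ⟨hm1, -⟩, hK, hKm⟩
        exact ⟨hK, Finset.card_pos.1 (by omega)⟩
    · intro m _ m' _ hmm'
      simp only [Function.onFun]
      rw [Finset.disjoint_left]
      intro K hK hK'
      rw [Finset.mem_filter] at hK hK'
      omega
  rw [hsplit]
  have hterm : ∀ m ∈ Finset.Ico 1 (N + 1),
      ∑ K ∈ (clusterShapes 1 Finset.univ Sd).filter (fun K => K.card = m),
        z ^ K.card * (a + b * K.card) ≤ (a + b) * (2 * B * z) ^ m := by
    intro m hm
    rw [Finset.mem_Ico] at hm
    have hm1 : 1 ≤ m := hm.1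
    have hc := card_clusterShapes_filter_card_le Sd hm1
    have hlin : a + b * m ≤ (a + b) * 2 ^ m := by
      have h2m : (m : ℝ) ≤ 2 ^ m := by
        have := Nat.lt_two_pow_self (n := m)
        exact_mod_cast this.le
      have h1 : (1 : ℝ) ≤ 2 ^ m := one_le_pow₀ (by norm_num)
      nlinarith
    calc ∑ K ∈ (clusterShapes 1 Finset.univ Sd).filter (fun K => K.card = m),
          z ^ K.card * (a + b * K.card)
        = ∑ K ∈ (clusterShapes 1 Finset.univ Sd).filter (fun K => K.card = m),
            z ^ m * (a + b * m) :=
          Finset.sum_congr rfl fun K hK => by rw [(Finset.mem_filter.1 hK).2]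
      _ = ((clusterShapes 1 Finset.univ Sd).filter (fun K => K.card = m)).card *
            (z ^ m * (a + b * m)) := by rw [Finset.sum_const, nsmul_eq_mul]
      _ ≤ B ^ m * (z ^ m * ((a + b) * 2 ^ m)) := by
          refine mul_le_mul hc (mul_le_mul_of_nonneg_left hlin (by positivity))
            (by positivity) (by positivity)
      _ = (a + b) * (2 * B * z) ^ m := by rw [mul_pow, mul_pow]; ring
  refine (Finset.sum_le_sum hterm).trans ?_
  rw [← Finset.mul_sum]
  have hy0 : 0 ≤ 2 * B * z := by positivity
  have hy : 2 * B * z ≤ 1 / 2 := by nlinarith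
  have hgeom := geom_sum_Ico_le_of_lt_one (m := 1) (n := N + 1) hy0 (by linarith)
  calc (a + b) * ∑ m ∈ Finset.Ico 1 (N + 1), (2 * B * z) ^ m
      ≤ (a + b) * ((2 * B * z) ^ 1 / (1 - 2 * B * z)) :=
        mul_le_mul_of_nonneg_left hgeom (by positivity)
    _ ≤ (a + b) * (2 * (2 * B * z)) := by
        refine mul_le_mul_of_nonneg_left ?_ (by positivity)
        rw [pow_one, div_le_iff₀ (by linarith)]
        nlinarith
    _ = 4 * (a + b) * B * z := by ring

/-! ### The sharp count: components with minimal representatives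

The crude bound `B^m` above is exponential in `|Sd| · m`; for seeds of unbounded size (the cells of
a general multi-cell observable) one needs the generating-function bound
`Σ_{K shape} u^{|K|} ≤ (1 + 2u)^{|Sd|}`, which follows from the INJECTIVE decomposition of a shape
into the components of its minimal seed cells. -/

section Sharp

variable (K : Finset (CoarseIdx μc))

/-- The linking relation inside `K` (symmetric). [folklore] -/
private def link : CoarseIdx μc → CoarseIdx μc → Prop := fun x y => cdist x y ≤ 1 ∧ x ∈ K ∧ y ∈ K

variable {K}

/-- The linking relation is symmetric. [folklore] -/
private theorem link_symm {x y : CoarseIdx μc} (h : link K x y) : link K y x :=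
  ⟨by rw [cdist_comm]; exact h.1, h.2.2, h.2.1⟩

/-- Its reflexive-transitive closure is symmetric. [folklore] -/
private theorem rtg_link_symm {x y : CoarseIdx μc} (h : Relation.ReflTransGen (link K) x y) :
    Relation.ReflTransGen (link K) y x := by
  induction h with
  | refl => exact Relation.ReflTransGen.refl
  | tail _ hbc ih => exact Relation.ReflTransGen.head (link_symm hbc) ih

/-- Membership in a component via the symmetric linking relation. [folklore] -/
theorem mem_comp_iff {s c : CoarseIdx μc} :
    c ∈ seedClosure (fun x y : CoarseIdx μc => cdist x y ≤ 1) K {s} ↔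
      c ∈ K ∧ s ∈ K ∧ Relation.ReflTransGen (fun x y : CoarseIdx μc => cdist x y ≤ 1 ∧ x ∈ K ∧ y ∈ K) s c := by
  rw [mem_seedClosure]
  constructor
  · rintro ⟨hcK, s', hs', hs'K, hchain⟩
    rw [Finset.mem_singleton] at hs'
    subst hs'
    refine ⟨hcK, hs'K, ?_⟩
    clear hcK
    induction hchain with
    | refl => exact Relation.ReflTransGen.refl
    | tail hab hbc ih =>
      exact ih.tail ⟨hbc.1, mem_of_reflTransGen_stepIn hs'K hab, hbc.2⟩
  · rintro ⟨hcK, hsK, hchain⟩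
    refine ⟨hcK, s, Finset.mem_singleton_self _, hsK, ?_⟩
    exact Relation.ReflTransGen.mono (fun x y h => ⟨h.1, h.2.2⟩) s c hchain

/-- Two components sharing a cell coincide: a cell of the component of `s` has the same component.
[folklore] -/
theorem comp_eq_of_mem {s s' : CoarseIdx μc}
    (hs' : s' ∈ seedClosure (fun x y : CoarseIdx μc => cdist x y ≤ 1) K {s}) :
    seedClosure (fun x y : CoarseIdx μc => cdist x y ≤ 1) K {s'} =
      seedClosure (fun x y : CoarseIdx μc => cdist x y ≤ 1) K {s} := by
  obtain ⟨hs'K, hsK, hss'⟩ := mem_comp_iff.1 hs'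
  ext c
  rw [mem_comp_iff, mem_comp_iff]
  constructor
  · rintro ⟨hcK, -, h⟩; exact ⟨hcK, hsK, hss'.trans h⟩
  · rintro ⟨hcK, -, h⟩; exact ⟨hcK, hs'K, (rtg_link_symm hss').trans h⟩

/-- An injective numbering of the cells (to choose minimal representatives). [folklore] -/
private def enc : CoarseIdx μc → ℕ := fun c => (Fintype.equivFin (CoarseIdx μc) c).val

/-- The numbering is injective. [folklore] -/
private theorem enc_injective : Function.Injective (enc (μc := μc)) :=
  Fin.val_injective.comp (Fintype.equivFin (CoarseIdx μc)).injective

variable (K) (Sd : Finset (CoarseIdx μc))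

/-- `s` is the minimal seed cell of its component. [folklore] -/
private def IsRep (s : CoarseIdx μc) : Prop :=
  s ∈ K ∧ ∀ s' ∈ Sd, s' ∈ seedClosure (fun x y : CoarseIdx μc => cdist x y ≤ 1) K {s} → enc s ≤ enc s'

open scoped Classical in
/-- The part of the shape attributed to the seed cell `s`: its component if `s` is the minimal
seed cell of that component, else nothing. [folklore] -/
private def repPart (s : CoarseIdx μc) : Finset (CoarseIdx μc) :=
  if IsRep K Sd s then seedClosure (fun x y : CoarseIdx μc => cdist x y ≤ 1) K {s} else ∅

variable {K Sd}

/-- Parts lie inside the shape. [folklore] -/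
private theorem repPart_subset (s : CoarseIdx μc) : repPart K Sd s ⊆ K := by
  unfold repPart; split_ifs
  · exact seedClosure_subset _ _
  · exact Finset.empty_subset _

/-- Every cell of a cluster shape lies in the part of some minimal seed cell. [folklore] -/
private theorem exists_rep_of_mem (hK : IsClusterShape (fun x y : CoarseIdx μc => cdist x y ≤ 1) Sd K)
    {k : CoarseIdx μc} (hk : k ∈ K) : ∃ s ∈ Sd, IsRep K Sd s ∧ k ∈ repPart K Sd s := by
  classical
  have hk' : k ∈ seedClosure (fun x y : CoarseIdx μc => cdist x y ≤ 1) K Sd := by rw [hK]; exact hk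
  obtain ⟨-, s₁, hs₁, hs₁K, hchain⟩ := mem_seedClosure.1 hk'
  have hk₁ : k ∈ seedClosure (fun x y : CoarseIdx μc => cdist x y ≤ 1) K {s₁} :=
    mem_seedClosure.2 ⟨hk, s₁, Finset.mem_singleton_self _, hs₁K, hchain⟩
  set T := Sd.filter fun s => s ∈ seedClosure (fun x y : CoarseIdx μc => cdist x y ≤ 1) K {s₁}
    with hT
  have hs₁comp : s₁ ∈ seedClosure (fun x y : CoarseIdx μc => cdist x y ≤ 1) K {s₁} :=
    mem_seedClosure.2 ⟨hs₁K, s₁, Finset.mem_singleton_self _, hs₁K, Relation.ReflTransGen.refl⟩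
  have hTne : T.Nonempty := ⟨s₁, Finset.mem_filter.2 ⟨hs₁, hs₁comp⟩⟩
  obtain ⟨s₀, hs₀T, hmin⟩ := Finset.exists_min_image T enc hTne
  obtain ⟨hs₀Sd, hs₀comp⟩ := Finset.mem_filter.1 hs₀T
  have hcomp : seedClosure (fun x y : CoarseIdx μc => cdist x y ≤ 1) K {s₀} =
      seedClosure (fun x y : CoarseIdx μc => cdist x y ≤ 1) K {s₁} := comp_eq_of_mem hs₀comp
  have hrep : IsRep K Sd s₀ := by
    refine ⟨seedClosure_subset _ _ hs₀comp, fun s' hs' hs'comp => hmin s' (Finset.mem_filter.2 ⟨hs', ?_⟩)⟩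
    rw [hcomp] at hs'comp; exact hs'comp
  refine ⟨s₀, hs₀Sd, hrep, ?_⟩
  unfold repPart
  rw [if_pos hrep, hcomp]
  exact hk₁

/-- Parts of distinct seed cells are disjoint. [folklore] -/
private theorem disjoint_repPart {s₁ s₂ : CoarseIdx μc} (h12 : s₁ ≠ s₂) (hs₁ : s₁ ∈ Sd) (hs₂ : s₂ ∈ Sd) :
    Disjoint (repPart K Sd s₁) (repPart K Sd s₂) := by
  classical
  unfold repPart
  split_ifs with h1 h2
  · rw [Finset.disjoint_left]
    intro c hc1 hc2
    have e1 := comp_eq_of_mem hc1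
    have e2 := comp_eq_of_mem hc2
    have e : seedClosure (fun x y : CoarseIdx μc => cdist x y ≤ 1) K {s₁} =
        seedClosure (fun x y : CoarseIdx μc => cdist x y ≤ 1) K {s₂} := e1.symm.trans e2
    have hs₂in : s₂ ∈ seedClosure (fun x y : CoarseIdx μc => cdist x y ≤ 1) K {s₁} := by
      rw [e]; exact mem_seedClosure.2 ⟨h2.1, s₂, Finset.mem_singleton_self _, h2.1,
        Relation.ReflTransGen.refl⟩
    have hs₁in : s₁ ∈ seedClosure (fun x y : CoarseIdx μc => cdist x y ≤ 1) K {s₂} := by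
      rw [← e]; exact mem_seedClosure.2 ⟨h1.1, s₁, Finset.mem_singleton_self _, h1.1,
        Relation.ReflTransGen.refl⟩
    have := le_antisymm (h1.2 s₂ hs₂ hs₂in) (h2.2 s₁ hs₁ hs₁in)
    exact h12 (enc_injective this)
  · exact Finset.disjoint_empty_right _
  · exact Finset.disjoint_empty_left _
  · exact Finset.disjoint_empty_left _

/-- A cluster shape is the disjoint union of the parts of its seed cells. [folklore] -/
private theorem eq_biUnion_repPart
    (hK : IsClusterShape (fun x y : CoarseIdx μc => cdist x y ≤ 1) Sd K) :
    K = Sd.biUnion (repPart K Sd) := by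
  classical
  ext c
  rw [Finset.mem_biUnion]
  constructor
  · intro hc
    obtain ⟨s, hs, -, hcs⟩ := exists_rep_of_mem hK hc
    exact ⟨s, hs, hcs⟩
  · rintro ⟨s, -, hcs⟩
    exact repPart_subset s hcs

/-- The cardinality of a shape is the sum of the cardinalities of its parts. [folklore] -/
private theorem card_eq_sum_repPart
    (hK : IsClusterShape (fun x y : CoarseIdx μc => cdist x y ≤ 1) Sd K) :
    K.card = ∑ s ∈ Sd, (repPart K Sd s).card := by
  classical
  conv_lhs => rw [eq_biUnion_repPart hK]
  rw [Finset.card_biUnion]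
  intro s₁ hs₁ s₂ hs₂ h12
  exact disjoint_repPart h12 hs₁ hs₂

/-- Each part is empty or a connected set through its seed cell. [folklore] -/
private theorem repPart_mem_family (s : CoarseIdx μc) :
    repPart K Sd s = ∅ ∨ (s ∈ repPart K Sd s ∧ IsCellConnectedFrom s (repPart K Sd s)) := by
  classical
  unfold repPart
  split_ifs
  · exact comp_empty_or_connected K s
  · exact Or.inl rfl

open scoped Classical in
/-- **Generating function of the connected sets through a point**: for `0 ≤ u` with
`(3^d+1)^2 u ≤ 1/2`, the sum of `u^{|A|}` over the family `{∅} ∪ {A ∋ s connected from s}` is at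
most `1 + 2u`. [folklore] -/
theorem sum_pow_card_connected_le (s : CoarseIdx μc) {u : ℝ} (hu : 0 ≤ u)
    (hXu : ((3 : ℝ) ^ d + 1) ^ 2 * u ≤ 1 / 2) :
    ∑ A ∈ (Finset.univ.filter fun A : Finset (CoarseIdx μc) =>
        A = ∅ ∨ (s ∈ A ∧ IsCellConnectedFrom s A)), u ^ A.card ≤ 1 + 2 * u := by
  classical
  set 𝒞 := Finset.univ.filter fun A : Finset (CoarseIdx μc) => s ∈ A ∧ IsCellConnectedFrom s A with h𝒞
  have hsplit : (Finset.univ.filter fun A : Finset (CoarseIdx μc) =>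
      A = ∅ ∨ (s ∈ A ∧ IsCellConnectedFrom s A)) ⊆ insert ∅ 𝒞 := by
    intro A hA
    rcases (Finset.mem_filter.1 hA).2 with h | h
    · exact h ▸ Finset.mem_insert_self _ _
    · exact Finset.mem_insert_of_mem (Finset.mem_filter.2 ⟨Finset.mem_univ _, h⟩)
  have h1 : ∑ A ∈ (Finset.univ.filter fun A : Finset (CoarseIdx μc) =>
      A = ∅ ∨ (s ∈ A ∧ IsCellConnectedFrom s A)), u ^ A.card ≤ ∑ A ∈ insert ∅ 𝒞, u ^ A.card :=
    Finset.sum_le_sum_of_subset_of_nonneg hsplit fun A _ _ => by positivity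
  refine h1.trans ?_
  have hempty : (∅ : Finset (CoarseIdx μc)) ∉ 𝒞 := fun h => by
    have := (Finset.mem_filter.1 h).2.1; simp at this
  rw [Finset.sum_insert hempty, Finset.card_empty, pow_zero]
  refine add_le_add le_rfl ?_
  -- group `𝒞` by cardinality `k + 1`
  set N : ℕ := Fintype.card (CoarseIdx μc) with hN
  have hsplit2 : ∑ A ∈ 𝒞, u ^ A.card =
      ∑ k ∈ Finset.range N, ∑ A ∈ 𝒞.filter (fun A => A.card = k + 1), u ^ A.card := by
    rw [← Finset.sum_biUnion]
    · apply Finset.sum_congr _ fun _ _ => rfl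
      ext A
      simp only [Finset.mem_biUnion, Finset.mem_range, Finset.mem_filter]
      constructor
      · intro hA
        have h1 : 1 ≤ A.card := Finset.card_pos.2 ⟨s, (Finset.mem_filter.1 hA).2.1⟩
        have h2 : A.card ≤ N := by
          rw [hN, ← Finset.card_univ]; exact Finset.card_le_card (Finset.subset_univ _)
        exact ⟨A.card - 1, by omega, hA, by omega⟩
      · rintro ⟨k, -, hA, -⟩; exact hA
    · intro k _ k' _ hkk'
      simp only [Function.onFun]
      rw [Finset.disjoint_left]
      intro A hA hA'
      rw [Finset.mem_filter] at hA hA'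
      omega
  rw [hsplit2]
  set X : ℝ := ((3 : ℝ) ^ d + 1) ^ 2 with hX
  have hterm : ∀ k ∈ Finset.range N,
      ∑ A ∈ 𝒞.filter (fun A => A.card = k + 1), u ^ A.card ≤ u * (X * u) ^ k := by
    intro k _
    have hc : ((𝒞.filter (fun A => A.card = k + 1)).card : ℝ) ≤ X ^ k := by
      have h := card_connectedCellFamily_le s k (𝒞.filter (fun A => A.card = k + 1)) fun A hA => by
        obtain ⟨hA, hAk⟩ := Finset.mem_filter.1 hA
        obtain ⟨-, hsA, hconn⟩ := Finset.mem_filter.1 hA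
        exact ⟨hsA, hAk.le, hconn⟩
      rw [hX, ← pow_mul]
      exact_mod_cast h
    calc ∑ A ∈ 𝒞.filter (fun A => A.card = k + 1), u ^ A.card
        = ∑ A ∈ 𝒞.filter (fun A => A.card = k + 1), u ^ (k + 1) :=
          Finset.sum_congr rfl fun A hA => by rw [(Finset.mem_filter.1 hA).2]
      _ = ((𝒞.filter (fun A => A.card = k + 1)).card : ℝ) * u ^ (k + 1) := by
          rw [Finset.sum_const, nsmul_eq_mul]
      _ ≤ X ^ k * u ^ (k + 1) := mul_le_mul_of_nonneg_right hc (by positivity)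
      _ = u * (X * u) ^ k := by rw [mul_pow, pow_succ]; ring
  refine (Finset.sum_le_sum hterm).trans ?_
  rw [← Finset.mul_sum]
  have hy0 : 0 ≤ X * u := by positivity
  have hgeom := geom_sum_Ico_le_of_lt_one (m := 0) (n := N) hy0 (by linarith)
  rw [← Finset.range_eq_Ico, pow_zero] at hgeom
  calc u * ∑ k ∈ Finset.range N, (X * u) ^ k ≤ u * (1 / (1 - X * u)) :=
        mul_le_mul_of_nonneg_left hgeom hu
    _ ≤ u * 2 := by
        refine mul_le_mul_of_nonneg_left ?_ hu
        rw [div_le_iff₀ (by linarith)]; linarith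
    _ = 2 * u := by ring

/-- **Sharp generating-function bound for the cluster shapes of a seed**: for `0 ≤ u` with
`(3^d+1)^2 u ≤ 1/2`, `Σ_{K shape} u^{|K|} ≤ (1 + 2u)^{|Sd|}` — the shape is encoded injectively by
the tuple of the components of its minimal seed cells, and the tuples factorise.
[folklore] -/
theorem sum_clusterShapes_pow_card_le (Sd : Finset (CoarseIdx μc)) {u : ℝ} (hu : 0 ≤ u)
    (hXu : ((3 : ℝ) ^ d + 1) ^ 2 * u ≤ 1 / 2) :
    ∑ K ∈ clusterShapes 1 Finset.univ Sd, u ^ K.card ≤ (1 + 2 * u) ^ Sd.card := by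
  classical
  let 𝒜 : CoarseIdx μc → Finset (Finset (CoarseIdx μc)) := fun s =>
    Finset.univ.filter fun A => A = ∅ ∨ (s ∈ A ∧ IsCellConnectedFrom s A)
  set φ : Finset (CoarseIdx μc) → ((s : CoarseIdx μc) → s ∈ Sd → Finset (CoarseIdx μc)) :=
    fun K s _ => repPart K Sd s with hφ
  set w : ((s : CoarseIdx μc) → s ∈ Sd → Finset (CoarseIdx μc)) → ℝ :=
    fun T => ∏ x ∈ Sd.attach, u ^ (T x.1 x.2).card with hw
  have hshape : ∀ K ∈ clusterShapes 1 Finset.univ Sd,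
      IsClusterShape (fun x y : CoarseIdx μc => cdist x y ≤ 1) Sd K := fun K hK =>
    (mem_clusterShapes.1 hK).2
  -- the weight of a shape is the weight of its tuple
  have hweight : ∀ K ∈ clusterShapes 1 Finset.univ Sd, u ^ K.card = w (φ K) := by
    intro K hK
    simp only [hw, hφ]
    rw [card_eq_sum_repPart (hshape K hK), ← Finset.prod_pow_eq_pow_sum, ← Finset.prod_attach]
  have hmaps : ∀ K ∈ clusterShapes 1 Finset.univ Sd, φ K ∈ Sd.pi 𝒜 := by
    intro K hK
    rw [Finset.mem_pi]
    intro s hs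
    exact Finset.mem_filter.2 ⟨Finset.mem_univ _, repPart_mem_family s⟩
  have hinj : Set.InjOn φ ↑(clusterShapes 1 Finset.univ Sd) := by
    intro K hK K' hK' hKK'
    rw [eq_biUnion_repPart (hshape K (Finset.mem_coe.1 hK)),
      eq_biUnion_repPart (hshape K' (Finset.mem_coe.1 hK'))]
    refine Finset.biUnion_congr rfl fun s hs => ?_
    exact congrFun (congrFun hKK' s) hs
  have hw0 : ∀ T, 0 ≤ w T := fun T => Finset.prod_nonneg fun x _ => by positivity
  calc ∑ K ∈ clusterShapes 1 Finset.univ Sd, u ^ K.card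
      = ∑ K ∈ clusterShapes 1 Finset.univ Sd, w (φ K) := Finset.sum_congr rfl hweight
    _ = ∑ T ∈ (clusterShapes 1 Finset.univ Sd).image φ, w T := (Finset.sum_image hinj).symm
    _ ≤ ∑ T ∈ Sd.pi 𝒜, w T :=
        Finset.sum_le_sum_of_subset_of_nonneg (Finset.image_subset_iff.2 hmaps) fun T _ _ => hw0 T
    _ = ∏ s ∈ Sd, ∑ A ∈ 𝒜 s, u ^ A.card := (Finset.prod_sum Sd 𝒜 fun s A => u ^ A.card).symm
    _ ≤ ∏ _s ∈ Sd, (1 + 2 * u) :=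
        Finset.prod_le_prod (fun s _ => Finset.sum_nonneg fun A _ => by positivity)
          fun s _ => sum_pow_card_connected_le s hu hXu
    _ = (1 + 2 * u) ^ Sd.card := Finset.prod_const _

/-- **Sharp weighted sum over the nonempty cluster shapes of a seed**: for `0 ≤ z`,
`4 (3^d+1)^2 z ≤ 1`, and `a, b ≥ 0`,
`Σ_{K shape, K ≠ ∅} z^{|K|} (a + b |K|) ≤ (a + b) ((1 + 4z)^{|Sd|} - 1)` — uniform in the seed
size, which is what the expansion around the cells of a general multi-cell observable needs.
[folklore] -/
theorem sum_clusterShapes_le_sharp (Sd : Finset (CoarseIdx μc)) {z a b : ℝ} (hz : 0 ≤ z)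
    (ha : 0 ≤ a) (hb : 0 ≤ b) (hXz : 4 * ((3 : ℝ) ^ d + 1) ^ 2 * z ≤ 1) :
    ∑ K ∈ (clusterShapes 1 Finset.univ Sd).filter (fun K => K.Nonempty),
        z ^ K.card * (a + b * K.card) ≤ (a + b) * ((1 + 4 * z) ^ Sd.card - 1) := by
  classical
  set u : ℝ := 2 * z with hu
  have hu0 : 0 ≤ u := by positivity
  have hX1 : (1 : ℝ) ≤ ((3 : ℝ) ^ d + 1) ^ 2 := one_le_pow₀ (by
    have : (0 : ℝ) ≤ (3 : ℝ) ^ d := by positivity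
    linarith)
  have hXu : ((3 : ℝ) ^ d + 1) ^ 2 * u ≤ 1 / 2 := by rw [hu]; linarith
  -- termwise: `z^m (a + b m) ≤ (a + b) u^m` for `m ≥ 1`
  have hterm : ∀ K ∈ (clusterShapes 1 Finset.univ Sd).filter (fun K => K.Nonempty),
      z ^ K.card * (a + b * K.card) ≤ (a + b) * u ^ K.card := by
    intro K hK
    have hm : 1 ≤ K.card := Finset.card_pos.2 (Finset.mem_filter.1 hK).2
    have h2m : (K.card : ℝ) ≤ 2 ^ K.card := by exact_mod_cast (Nat.lt_two_pow_self (n := K.card)).le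
    have hm1 : (1 : ℝ) ≤ K.card := by exact_mod_cast hm
    have hab : a + b * K.card ≤ (a + b) * 2 ^ K.card := by nlinarith
    calc z ^ K.card * (a + b * K.card) ≤ z ^ K.card * ((a + b) * 2 ^ K.card) :=
          mul_le_mul_of_nonneg_left hab (by positivity)
      _ = (a + b) * u ^ K.card := by rw [hu, mul_pow]; ring
  refine (Finset.sum_le_sum hterm).trans ?_
  rw [← Finset.mul_sum]
  refine mul_le_mul_of_nonneg_left ?_ (by positivity)
  -- the sum over nonempty shapes is the full sum minus the empty shape
  have hempty : (∅ : Finset (CoarseIdx μc)) ∈ clusterShapes 1 Finset.univ Sd := by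
    rw [mem_clusterShapes]
    refine ⟨Finset.empty_subset _, ?_⟩
    simp [IsClusterShape, seedClosure]
  have hsplit : ∑ K ∈ clusterShapes 1 Finset.univ Sd, u ^ K.card =
      1 + ∑ K ∈ (clusterShapes 1 Finset.univ Sd).filter (fun K => K.Nonempty), u ^ K.card := by
    rw [← Finset.sum_filter_add_sum_filter_not _ (fun K : Finset (CoarseIdx μc) => K.Nonempty)]
    have : (clusterShapes 1 Finset.univ Sd).filter (fun K => ¬ K.Nonempty) = {∅} := by
      ext K
      simp only [Finset.mem_filter, Finset.not_nonempty_iff_eq_empty, Finset.mem_singleton]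
      constructor
      · rintro ⟨-, h⟩; exact h
      · intro h; exact ⟨h ▸ hempty, h⟩
    rw [this, Finset.sum_singleton, Finset.card_empty, pow_zero]
    ring
  have htot := sum_clusterShapes_pow_card_le Sd hu0 hXu
  have e : 1 + 2 * u = 1 + 4 * z := by rw [hu]; ring
  rw [e] at htot
  linarith

end Sharp

end Literature.Probability.LatticeModels
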